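import Summits.ABC.IUTFork.Joshi.DictionaryCollation
import Summits.ABC.IUTFork.Joshi.TestIsmScalingShells
import HarnessLib

/-!
# Block-E TEST file: X-07′'s (Ind2)-move IS a label-by-label Joshi σ-move through a T-18 dictionary — the §8.11 reading of
# `IsmScaling.untiltFamily` ([J-III] = arXiv:2401.13508v4 §8.11.1 p.91 l.35–50 «Ind2 = change of the point y ∈ 𝒴»; Thm 4.2.2.1 (4))

Test file of the abc-iut cell, branch E (rung LADDER-ABC:A2.E; seat abc-iut-E-t18, «cx hand on X-07′ consequences», ASSIGNMENTS v2). **No side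
is taken** on [IUTchIII] Cor. 3.12, on Joshi's claims, or on Mochizuki's report on them; typed ≠ proved ≠ endorsed; a model EXHIBITS
satisfiability of typed hypotheses, nothing more. NO abc claim.

THE POINT. Mochizuki's Ansatz tuple `z = (y_1, …, y_{ℓ*})` carries ONE arithmetic holomorphic structure PER LABEL `j` ([J-III] Def 4.2.2; the
Θ-pilot at label `j` is evaluated at `y_j`), and Joshi's Ind2 move — «the indeterminacy of the point y ∈ 𝒴_{L′} which provides the arithmetic
holomorphic structure», p.91 l.37–38 — changes `y_j` label by label (Thm 4.2.2.1 (4): `|−|_{K_{y′_{w,j}}} = |−|^{j²}_{K_{y′_{w,1}}}`). T-18's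
`IndDictionary.toPacketAut` realises a §8.11 move UNIFORMLY in the label; this file adds the LABEL-AWARE realisation `realiseFamily v σ` of a
label-indexed family of §8.11 Ind2 moves `σ_j ∈ AutG (v_j)` (at label `j` the move `σ_j` acts, through the dictionary, on every tensor
factor and summand of the label-`j` packets — D-10's `factorwiseFamily` with `g j i v := carrierAut (v j) (σ j) v`), proves it lies in OUR
(Ind2)- and (Ind1)-families under the T-18 hypotheses (§1), and then identifies E-t41's X-07′ move: **`IsmScaling.untiltFamily p` (the
(Ind2)-family carrying `B_{j²}` onto `B_1`, `Joshi/TestIsmScalingShells.lean` p431238) EQUALS `realiseFamily` of the Joshi σ-moves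
«dilate by `p^{1−j}` at label `j`» through the explicit T-18 dictionary `dilationDictionary p` over the X-07′ carriers `scalShells`**
(`untiltFamily_eq_realiseFamily`; the scalar identity `(p^{1−j})^{j+1} = p^{1−j²}` on the `(j+1)`-tensor packet). So «JInd2InIsm TRUE at
X-07′ by construction» (E-plan 06:50:08Z) is literally about the move the X-07′ model uses: at `scalShells` (Ism = univ) the dilation
dictionary satisfies `JInd2InIsm` and its label-family realisation IS the model's `untiltFamily`; at the pinned carriers `signShells` (Ism =
{±1}) the same dictionary violates `JInd2InIsm` (T-18's `not_jInd2InIsm_of_rescaling` shape, restated here as `not_mem_signs_dilation`).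
[claim: Joshi2024ATS3, status: disputed]; our side [claim: Mochizuki2012, status: disputed]. Standard axioms only.
-/

noncomputable section

namespace Summit.ABC.IUTFork.Joshi.ATS3

open Function Set Thm311

variable {T : ThetaIndex}

/-! ## 1. Label-aware realisation of a family of §8.11 moves -/

namespace IndDictionary

variable {𝔍 : RosettaIndDatum} {L : LogShells T} (𝔇 : IndDictionary 𝔍 L)

/-- **Label-aware realisation of a family of Ind2 moves**: the packet-automorphism family acting, at each label `j`, by the container
automorphisms of Joshi's Ind2 element `σ_j ∈ AutG (v_j)` on every tensor factor and summand of the label-`j` packets (D-10's `factorwiseFamily`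
with `g j i w := 𝔇.carrierAut (v j) (σ j) w`). The shape in which a change of the `j`-th coordinate `y_j` of the Ansatz tuple acts ([J-III] Def
4.2.2, Thm 4.2.2.1 (4)); T-18's `toPacketAut` is the label-uniform case. DATA. [claim: Joshi2024ATS3, status: disputed] -/
def realiseFamily (v : T.Label → 𝔍.V) (σ : ∀ j : T.Label, 𝔍.AutG (v j)) : L.PacketAut :=
  factorwiseFamily L fun j _ w => 𝔇.carrierAut (v j) (σ j) w

/-- At each label the family is the (label-uniform) placewise realisation of that label's move. [folklore] -/
theorem realiseFamily_apply (v : T.Label → 𝔍.V) (σ : ∀ j : T.Label, 𝔍.AutG (v j)) (j : T.Label) (vQ : T.VQ) :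
    𝔇.realiseFamily v σ j vQ = placewiseFamily L (𝔇.carrierAut (v j) (σ j)) j vQ := rfl

/-- Under `JInd2InIsm` every label-family of Ind2 elements is realised inside OUR (Ind2)-family ([IUTchIII] Thm 3.11 (i) (Ind2) lets the
Ism-element depend on the label, the factor and the summand). DERIVED. [claim: Mochizuki2012, status: disputed] -/
theorem realiseFamily_mem_Ind2Family (h2 : 𝔇.JInd2InIsm) (v : T.Label → 𝔍.V) (σ : ∀ j : T.Label, 𝔍.AutG (v j)) :
    𝔇.realiseFamily v σ ∈ L.Ind2Family :=
  factorwiseFamily_mem_Ind2Family L fun j _ w => h2 (v j) (σ j) w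

/-- … hence inside the indeterminacy subgroup. DERIVED. [claim: Mochizuki2012, status: disputed] -/
theorem realiseFamily_mem_closure (h2 : 𝔇.JInd2InIsm) (v : T.Label → 𝔍.V) (σ : ∀ j : T.Label, 𝔍.AutG (v j)) :
    𝔇.realiseFamily v σ ∈ Subgroup.closure (L.Ind1Family ∪ L.Ind2Family) :=
  Subgroup.subset_closure (Or.inr (𝔇.realiseFamily_mem_Ind2Family h2 v σ))

variable {S : LatticeSituation T} {𝔍' : RosettaIndDatum} (𝔇' : IndDictionary 𝔍' S.L) (𝔈 : Joshi.Dictionary S)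

/-- **`MovesAreInd` for a seed dictionary whose moves are label-families of Joshi's Ind2 elements** (the shape of the X-07′ model dictionary,
E-t41 part III: one move realised as `untiltFamily`): `JInd2InIsm` suffices. Kernel glue. [claim: Mochizuki2012, status: disputed] -/
theorem movesAreInd_of_realiseFamily (h2 : 𝔇'.JInd2InIsm)
    (hf : ∀ g : 𝔈.Move, ∃ (v : T.Label → 𝔍'.V) (σ : ∀ j : T.Label, 𝔍'.AutG (v j)), 𝔈.real g = 𝔇'.realiseFamily v σ) :
    Joshi.MovesAreInd 𝔈 := fun g => by
  obtain ⟨v, σ, hg⟩ := hf g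
  rw [hg]
  exact 𝔇'.realiseFamily_mem_closure h2 v σ

end IndDictionary

/-! ## 2. The X-07′ junction: `untiltFamily` = the dilation σ-moves `p^{1−j}` through an explicit T-18 dictionary over `scalShells` -/

section ScalShells

open Cor312 Cor312.Checks Cor312.IdentifiedNonVacuity Cor312Vol Cor312Vol.NaiveWitness Cor312Vol.PinnedWitness Joshi.IsmScaling

variable (p : ℕ) [hp : Fact p.Prime]

/-- **A minimal Joshi datum carrying the dilation moves** (one place; arithmetic holomorphic structures and holomorphoids indexed by `ℤ` = the
Frobenius column, [J-IIp] Thm 10.15.1; Ind2 group `ℤ` of exponents `a` — the dilations `p^a`, [J-I] §10 / E-t1's `ActionDilates`; the other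
fields degenerate). A MODEL for exhibiting moves, asserting nothing about Joshi's objects. [claim: Joshi2024ATS3, status: disputed] -/
def dilationDatum : RosettaIndDatum where
  V := Unit
  pchar _ := p
  Yloc _ := ℤ
  frobLoc _ n := n + 1
  Hol _ := ℤ
  holOf _ n := n
  GrpIso _ := Unit
  pi1 _ _ := ()
  pi1_holOf _ _ _ := rfl
  AutG _ := ℤ
  autAct _ _ := Equiv.refl ℤ
  Fld _ := Unit
  base _ := ()
  anab _ _ _ := True
  anab_equiv _ := ⟨fun _ => trivial, fun _ => trivial, fun _ _ => trivial⟩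
  fiso _ _ _ := True
  anab_of_fiso _ _ _ _ := trivial
  Curve _ := Unit
  curveOf _ _ := ()
  Bv _ := ℚ
  pMul _ x := p * x
  kummerGen _ n := (p : ℚ) ^ n
  lstar := 1
  lstar_pos := Nat.one_pos
  ansatz := Set.univ

/-- **The dilation dictionary over a ℚ-line signature** (`lineShells A I`: `signShells` and `scalShells` alike): the Ind2 element `a ∈ ℤ`
acts on every container line by `x ↦ p^a·x` (E-t41's `ppowUnit`); Ind1 half trivial. DATA. [claim: Joshi2024ATS3, status: disputed] -/
def dilationDictionary (A I : Set (ℚ ≃ₗ[ℚ] ℚ)) (hA : LinearEquiv.refl ℚ ℚ ∈ A) (hI : LinearEquiv.refl ℚ ℚ ∈ I) :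
    IndDictionary (dilationDatum p) (lineShells A I hA hI) :=
  ⟨fun _ => (), fun _ a _ => LinearEquiv.smulOfUnit (ppowUnit p a), fun _ _ _ => LinearEquiv.refl ℚ ℚ, fun _ => 0⟩

/-- The dilation dictionary's Ind2 element `a` acts on a container line by `y ↦ p^a·y`. [folklore] -/
theorem dilationDictionary_apply (A I : Set (ℚ ≃ₗ[ℚ] ℚ)) (hA : LinearEquiv.refl ℚ ℚ ∈ A) (hI : LinearEquiv.refl ℚ ℚ ∈ I)
    (a : ℤ) (y : ℚ) : (dilationDictionary p A I hA hI).carrierAut () a () y = (p : ℚ) ^ a * y := by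
  simp [dilationDictionary, LinearEquiv.smulOfUnit, ppowUnit, Units.smul_def]

/-- The label-family of Joshi σ-moves «dilate by `p^{1−j}` at label `j`» (exponents in the Ind2 group `ℤ` of `dilationDatum`).
[claim: Joshi2024ATS3, status: disputed] -/
def untiltExponents : ∀ j : toyIndex.Label, (dilationDatum p).AutG ((fun _ : toyIndex.Label => ()) j) :=
  fun j => ((1 : ℤ) - ((j : ℕ) : ℤ) : ℤ)

/-- E-t41's explicit (Ind2)-family acts on the label-`j` packet as the scalar `u_j`. [folklore] -/
theorem scaleFamily_apply (u : toyIndex.Label → ℚˣ) (j : toyIndex.Label) (vQ : toyIndex.VQ) (x : scalShells.Packet j vQ) :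
    scaleFamily u j vQ x = (u j : ℚ) • x := by
  have h := factorwise_eq_smul j vQ
    (fun i => scalShells.summandwise vQ fun _ => LinearEquiv.smulOfUnit (factorUnits j (u j) i))
    (fun i => (factorUnits j (u j) i : ℚ)) (fun i y => by funext v; rfl) x
  rw [prod_factorUnits] at h
  exact h

/-- The dilation dictionary's label-family realisation acts on the label-`j` packet (a `(j+1)`-fold tensor power of the line) as the scalar
`(p^{1−j})^{j+1}`. [folklore] -/
theorem realiseFamily_untilt_apply (j : toyIndex.Label) (vQ : toyIndex.VQ) (x : scalShells.Packet j vQ) :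
    (dilationDictionary p signs Set.univ (Set.mem_insert _ _) (Set.mem_univ _)).realiseFamily (fun _ => ()) (untiltExponents p) j vQ x =
      (((p : ℚ) ^ ((1 : ℤ) - ((j : ℕ) : ℤ))) ^ ((j : ℕ) + 1)) • x := by
  have h := factorwise_eq_smul j vQ
    (fun _ => scalShells.summandwise vQ fun _ => LinearEquiv.smulOfUnit (ppowUnit p ((1 : ℤ) - ((j : ℕ) : ℤ))))
    (fun _ => (p : ℚ) ^ ((1 : ℤ) - ((j : ℕ) : ℤ))) (fun i y => by funext v; rfl) x
  rw [Finset.prod_const, Finset.card_univ, Fintype.card_fin] at h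
  unfold IndDictionary.realiseFamily factorwiseFamily
  exact h

omit hp in
/-- The exponent identity `(1 − j)(j + 1) = 1 − j²`. [folklore] -/
theorem dilation_exponent (j : toyIndex.Label) :
    ((p : ℚ) ^ ((1 : ℤ) - ((j : ℕ) : ℤ))) ^ ((j : ℕ) + 1) = (p : ℚ) ^ ((1 : ℤ) - jsq j) := by
  rw [← zpow_natCast, ← zpow_mul]
  congr 1
  simp only [jsq]
  push_cast
  ring

/-- **THE JUNCTION: X-07′'s move is Joshi's label-wise untilt change through a T-18 dictionary.** E-t41's `untiltFamily p` (scaling by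
`p^{1−j²}` on ONE tensor factor at label `j`, carrying `B_{j²}` onto `B_1`) and the label-family realisation of the σ-moves «dilate by `p^{1−j}`
at label `j`» through `dilationDictionary p` over `scalShells` (the SAME dilation on ALL `j+1` factors) are EQUAL packet automorphisms — both are
the scalar `p^{1−j²}` on the label-`j` packet. [claim: Joshi2024ATS3, status: disputed] -/
theorem untiltFamily_eq_realiseFamily :
    untiltFamily p =
      (dilationDictionary p signs Set.univ (Set.mem_insert _ _) (Set.mem_univ _)).realiseFamily (fun _ => ()) (untiltExponents p) := by
  funext j vQ
  apply LinearEquiv.ext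
  intro x
  rw [realiseFamily_untilt_apply, dilation_exponent]
  exact scaleFamily_apply (fun j => ppowUnit p (1 - jsq j)) j vQ x

/-- **(+) horn, on the model's own move**: at `scalShells` the dilation dictionary satisfies `JInd2InIsm` (Ism = univ) and `JInd1InStripAut`
(trivial Ind1 half), so `untiltFamily` lies in the indeterminacy subgroup AS the realisation of Joshi σ-moves (E-t41 proves the membership
directly as `scaleFamily_mem_closure`; here it is DERIVED from the T-18 hypotheses). [claim: Joshi2024ATS3, status: disputed] -/
theorem jInd2InIsm_dilationDictionary_scalShells :
    (dilationDictionary p signs Set.univ (Set.mem_insert _ _) (Set.mem_univ _)).JInd2InIsm ∧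
      (dilationDictionary p signs Set.univ (Set.mem_insert _ _) (Set.mem_univ _)).JInd1InStripAut :=
  ⟨fun _ _ _ => Set.mem_univ _, fun _ _ _ => Set.mem_insert _ _⟩

/-- Hence X-07′'s move lies in `Subgroup.closure (Ind1Family ∪ Ind2Family)` of `scalShells` BY WAY OF the §8.11 dictionary. [claim: Mochizuki2012, status: disputed] -/
theorem untiltFamily_mem_closure_via_dictionary :
    untiltFamily p ∈ Subgroup.closure (scalShells.Ind1Family ∪ scalShells.Ind2Family) := by
  rw [untiltFamily_eq_realiseFamily]
  exact (dilationDictionary p signs Set.univ (Set.mem_insert _ _) (Set.mem_univ _)).realiseFamily_mem_closure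
    (jInd2InIsm_dilationDictionary_scalShells p).1 (fun _ => ()) (untiltExponents p)

/-- **(−) horn, on the same dictionary**: over the pinned carriers `signShells` (Ism = {±1}) the dilation dictionary VIOLATES `JInd2InIsm` — the
dilation `p^a`, `a ≠ 0`, is not a sign. [claim: Joshi2024ATS3, status: disputed] -/
theorem not_jInd2InIsm_dilationDictionary_signs :
    ¬ (dilationDictionary p signs signs (Set.mem_insert _ _) (Set.mem_insert _ _)).JInd2InIsm := by
  intro h2
  obtain ⟨s, hs, hy⟩ := exists_eq_mul_of_mem_signs (h2 () (1 : ℤ) ())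
  have e : (p : ℚ) = s := by
    have h := hy 1
    rw [dilationDictionary_apply] at h
    simpa using h
  have hp1 : (1 : ℚ) < p := by exact_mod_cast hp.out.one_lt
  have : |(p : ℚ)| = 1 := e ▸ hs
  rw [abs_of_pos (by positivity)] at this
  exact absurd this (ne_of_gt hp1)

end ScalShells

end Summit.ABC.IUTFork.Joshi.ATS3

end
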